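import Literature.AlgebraicGeometry.Motives.HodgeLieWeightOneGradingTwoConstants
import HarnessLib

/-!
# Weight-one Hodge structures with `dim 𝔤⁺ = dim 𝔤⁰ = 2` and `𝔷 = 0`, III: the two complementary REAL idempotents
# `πᵢ = αᵢ⁻¹(EᵢFᵢ + FᵢEᵢ)` commuting with `𝔤` (`π₁ + π₂ = 1`, `π₁π₂ = 0`) — `𝔤 = 𝔤π₁ ⊕ 𝔤π₂`, two `𝔰𝔩₂` over `ℂ`

Family `hodge`, layer `Literature/AlgebraicGeometry/Motives`; THEOREMS ONLY (no definition, no named fact; D-0026).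
Sixth abstract file of the lane MT-RANK-SEVEN-SIMPLE of the cell `pub-hodgecm2` (COR-CM), seat `b27` gen 40; sequel of
`Motives/HodgeLieWeightOneGradingTwo{Roots,Constants}` (root vectors `E₁, E₂ ∈ 𝔤⁺`, `Fᵢ = Ēᵢ ∈ 𝔤⁻`,
`E₁F₂ = F₂E₁ = E₂F₁ = F₁E₂ = 0`, real constants `EᵢFᵢEᵢ = αᵢEᵢ`, `FᵢEᵢFᵢ = αᵢFᵢ`).  Setting as there (`H` of
weight `1`, polarization `ψ`, graded basis `e`, `P = gradingEnd e deg`, `𝔤 = 𝔥_ℂ`, `𝔷 = 0`, `dim 𝔤⁺ = dim 𝔤⁰ = 2`).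

* **`exists_projectorPair`** — THE PROJECTORS: `π₁, π₂` idempotent, `π₁π₂ = π₂π₁ = 0`, **`π₁ + π₂ = 1`**
  (`R = 1 − π₁ − π₂` kills every root vector on both sides, so `(2P−1)R ∈ 𝔤⁰` is central in `𝔤` — `𝔤⁰` is abelian —
  hence `0` as `𝔷 = 0`, and `R = (2P−1)²R = 0`), both REAL, commuting with `P` and with every element of `𝔤` (for
  `Z ∈ 𝔤⁰`: `[Z,E₁] = aE₁ + bE₂`, `[Z,F₁] = cF₁ + dF₂` give `[Z, π₁] = (a + c)π₁`, and `π₁[Z,π₁]π₁ = 0` forces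
  `a + c = 0`), hence **`πᵢ ∈ End_Hdg(V) ⊗ ℂ`** (`mem_span_endAlg_of_forall_commute`); `πᵢ ≠ 0`; and
  **`𝔤⁰ = ℂ[E₁,F₁] ⊕ ℂ[E₂,F₂]`** with `[Eᵢ,Fᵢ] = αᵢ(2P−1)πᵢ`: `𝔤 = 𝔤π₁ ⊕ 𝔤π₂` is the sum of two commuting
  `𝔰𝔩₂`-triples over `ℂ` acting on `V_ℂ = π₁V_ℂ ⊕ π₂V_ℂ` — Moonen–Zarhin's `Res_{K/ℚ} SL₂`-shapes
  `(std ⊠ 1)^k ⊕ (1 ⊠ std)^k`.  The `πᵢ` are NOT rational in the `ℚ`-simple case; the sequel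
  `Motives/HodgeLieWeightOneGradingTwoCommutant` computes `End_Hdg(V) ⊗ ℂ` (dimension `k₁² + k₂²`) and its centre
  `ℂπ₁ ⊕ ℂπ₂`.

## References

* [MoonenZarhin1999LowDim] B. Moonen, Yu. Zarhin, *Hodge classes on abelian varieties of low dimension*, Math. Ann. 315
  (1999), §2 and (2.3).
* [Deligne1982HodgeCycles] P. Deligne, *Hodge cycles on abelian varieties*, LNM 900 (1982), I §3 (proof of Prop. 3.4,
  3.6).
* [Zarhin1983HodgeGroupsK3] Yu. Zarhin, *Hodge groups of K3 surfaces*, J. reine angew. Math. 341 (1983), §2.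
-/

noncomputable section

open scoped TensorProduct

namespace Literature.AlgebraicGeometry.Motives

universe u

namespace HodgeStructure

open ProjectorBlocks Literature.RepresentationTheory.GeneralLinear

variable {V : Type u} [AddCommGroup V] [Module ℚ V] [Module.Finite ℚ V] [HodgeTensorFacts.{u, u}] {n : ℤ}
  {S : Type u} [Fintype S] [DecidableEq S] {deg : S → ℤ}

/-! ## §3 The two complementary projectors -/

/-- **The projectors `π₁, π₂` when `dim 𝔤⁺ = dim 𝔤⁰ = 2` and `𝔷 = 0`.**  There are root vectors `E₁, E₂`
(spanning `𝔤⁺`, linearly independent) with conjugates `F₁, F₂` (spanning `𝔤⁻`), `E₁F₂ = F₂E₁ = E₂F₁ = F₁E₂ = 0`,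
non-zero real constants `αᵢ` with `EᵢFᵢEᵢ = αᵢEᵢ`, `FᵢEᵢFᵢ = αᵢFᵢ`, and for **`πᵢ = αᵢ⁻¹(EᵢFᵢ + FᵢEᵢ)`**:
`πᵢ² = πᵢ`, `π₁π₂ = π₂π₁ = 0`, **`π₁ + π₂ = 1`**, `Pπᵢ = πᵢP`, `πᵢ` REAL (`conj ∘ πᵢ ∘ conj = πᵢ`), **`πᵢ` commutes
with every element of `𝔤`**, `πᵢ ∈ End_Hdg(V) ⊗ ℂ`, `πᵢ ≠ 0`; moreover `𝔤⁰ ∋ Z ⟹ Z = a[E₁,F₁] + b[E₂,F₂]`.  PROOF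
of `π₁ + π₂ = 1`: `R = 1 − π₁ − π₂` kills every `Eᵢ`, `Fᵢ` on both sides and commutes with `P`, so `(2P−1)R ∈ 𝔤⁰` is
central in `𝔤` (`𝔤⁰` abelian), hence `0` (`𝔷 = 0`), and `R = (2P−1)²R = 0`.  PROOF that `π₁` commutes with
`Z ∈ 𝔤⁰`: `[Z,E₁] = aE₁ + bE₂`, `[Z,F₁] = cF₁ + dF₂` give `[Z, E₁F₁ + F₁E₁] = (a + c)(E₁F₁ + F₁E₁)`, and
`π₁[Z,π₁]π₁ = 0` forces `a + c = 0`. [cite: MoonenZarhin1999LowDim, §2 and (2.3)]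
[cite: Deligne1982HodgeCycles, I §3 (proof of Prop. 3.4, 3.6)] [cite: Zarhin1983HodgeGroupsK3, §2] -/
theorem exists_projectorPair (H : HodgeStructure V n) (ψ : H.Polarization) (hn : n = 1)
    (e : Module.Basis S ℂ (ℂ ⊗[ℚ] V)) (hF : ∀ a, H.F a = Submodule.span ℂ (e '' {σ | a ≤ deg σ}))
    (hFc : ∀ a, complexConj (H.F a) = Submodule.span ℂ (e '' {σ | deg σ ≤ n - a}))
    (hdeg : ∀ σ, deg σ = 0 ∨ deg σ = 1) (hcenter : H.hodgeLie ⊓ Subalgebra.toSubmodule H.endAlg = ⊥)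
    (hp2 : Module.finrank ℂ (H.hodgeLieC ⊓ Module.End.eigenspace
        (LinearMap.mulLeft ℂ (gradingEnd e deg) - LinearMap.mulRight ℂ (gradingEnd e deg)) 1 : Submodule ℂ _) = 2)
    (h02 : Module.finrank ℂ (H.hodgeLieC ⊓ Module.End.eigenspace
        (LinearMap.mulLeft ℂ (gradingEnd e deg) - LinearMap.mulRight ℂ (gradingEnd e deg)) 0 : Submodule ℂ _) = 2) :
    ∃ (E₁ E₂ F₁ F₂ π₁ π₂ : Module.End ℂ (ℂ ⊗[ℚ] V)) (α₁ α₂ : ℂ),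
      (E₁ ∈ H.hodgeLieC ∧ E₂ ∈ H.hodgeLieC ∧ F₁ ∈ H.hodgeLieC ∧ F₂ ∈ H.hodgeLieC) ∧
      (gradingEnd e deg * E₁ * (1 - gradingEnd e deg) = E₁ ∧ gradingEnd e deg * E₂ * (1 - gradingEnd e deg) = E₂ ∧
        (1 - gradingEnd e deg) * F₁ * gradingEnd e deg = F₁ ∧ (1 - gradingEnd e deg) * F₂ * gradingEnd e deg = F₂) ∧
      ((∀ v, F₁ v = conj (E₁ (conj v))) ∧ (∀ v, F₂ v = conj (E₂ (conj v)))) ∧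
      (∀ x y : ℂ, x • E₁ + y • E₂ = 0 → x = 0 ∧ y = 0) ∧
      (∀ E ∈ H.hodgeLieC, gradingEnd e deg * E * (1 - gradingEnd e deg) = E → ∃ x y : ℂ, E = x • E₁ + y • E₂) ∧
      (∀ F ∈ H.hodgeLieC, (1 - gradingEnd e deg) * F * gradingEnd e deg = F → ∃ x y : ℂ, F = x • F₁ + y • F₂) ∧
      (E₁ * F₂ = 0 ∧ F₂ * E₁ = 0 ∧ E₂ * F₁ = 0 ∧ F₁ * E₂ = 0) ∧
      (α₁ ≠ 0 ∧ α₂ ≠ 0 ∧ starRingEnd ℂ α₁ = α₁ ∧ starRingEnd ℂ α₂ = α₂ ∧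
        E₁ * F₁ * E₁ = α₁ • E₁ ∧ F₁ * E₁ * F₁ = α₁ • F₁ ∧ E₂ * F₂ * E₂ = α₂ • E₂ ∧ F₂ * E₂ * F₂ = α₂ • F₂) ∧
      (π₁ = α₁⁻¹ • (E₁ * F₁ + F₁ * E₁) ∧ π₂ = α₂⁻¹ • (E₂ * F₂ + F₂ * E₂)) ∧
      (π₁ * π₁ = π₁ ∧ π₂ * π₂ = π₂ ∧ π₁ * π₂ = 0 ∧ π₂ * π₁ = 0 ∧ π₁ + π₂ = 1) ∧
      (gradingEnd e deg * π₁ = π₁ * gradingEnd e deg ∧ gradingEnd e deg * π₂ = π₂ * gradingEnd e deg) ∧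
      ((∀ v, π₁ v = conj (π₁ (conj v))) ∧ (∀ v, π₂ v = conj (π₂ (conj v)))) ∧
      ((∀ Y ∈ H.hodgeLieC, π₁ * Y = Y * π₁) ∧ (∀ Y ∈ H.hodgeLieC, π₂ * Y = Y * π₂)) ∧
      (π₁ ∈ Submodule.span ℂ ((fun a : Module.End ℚ V => a.baseChange ℂ) '' (H.endAlg : Set (Module.End ℚ V))) ∧
        π₂ ∈ Submodule.span ℂ ((fun a : Module.End ℚ V => a.baseChange ℂ) '' (H.endAlg : Set (Module.End ℚ V)))) ∧
      (π₁ ≠ 0 ∧ π₂ ≠ 0) ∧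
      (∀ Z ∈ H.hodgeLieC, gradingEnd e deg * Z = Z * gradingEnd e deg →
        ∃ a b : ℂ, Z = a • (E₁ * F₁ - F₁ * E₁) + b • (E₂ * F₂ - F₂ * E₂)) := by
  classical
  have hPP := gradingEnd_mul_gradingEnd_of_deg e hdeg
  obtain ⟨E₁, E₂, F₁, F₂, hE₁g, hE₂g, hF₁g, hF₂g, hE₁, hE₂, hF₁m, hF₂m, hF₁, hF₂, hind, hspanE, hspanF,
    k12, k12', k21, k21'⟩ := exists_rootVectors H ψ hn e hF hFc hdeg hcenter hp2 h02
  obtain ⟨α₁, hα₁, hα₁re, hEFE₁, hFEF₁⟩ := exists_smul_of_rootVectors H ψ hn e hF hFc hdeg hE₁g hE₂g hF₁g hE₁ hE₂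
    hF₁ hF₂ hind hspanE k12 k21'
  obtain ⟨α₂, hα₂, hα₂re, hEFE₂, hFEF₂⟩ := exists_smul_of_rootVectors H ψ hn e hF hFc hdeg hE₂g hE₁g hF₂g hE₂ hE₁
    hF₂ hF₁ (fun x y h => (hind y x (by rw [add_comm]; exact h)).symm)
    (fun E hEg hEm => by obtain ⟨x, y, h⟩ := hspanE E hEg hEm; exact ⟨y, x, by rw [h, add_comm]⟩) k21 k12'
  set P := gradingEnd e deg with hP
  set Θ : Module.End ℂ (ℂ ⊗[ℚ] V) := (2 : ℂ) • P - 1 with hΘdef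
  set π₁ : Module.End ℂ (ℂ ⊗[ℚ] V) := α₁⁻¹ • (E₁ * F₁ + F₁ * E₁) with hπ₁
  set π₂ : Module.End ℂ (ℂ ⊗[ℚ] V) := α₂⁻¹ • (E₂ * F₂ + F₂ * E₂) with hπ₂
  obtain ⟨hππ₁, hPπ₁, hπP₁, hEπ₁, hπE₁, hFπ₁, hπF₁, hΘπ₁⟩ := rootProjector_identities e hdeg hE₁ hF₁m hα₁ hEFE₁ hFEF₁
  obtain ⟨hππ₂, hPπ₂, hπP₂, hEπ₂, hπE₂, hFπ₂, hπF₂, hΘπ₂⟩ := rootProjector_identities e hdeg hE₂ hF₂m hα₂ hEFE₂ hFEF₂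
  rw [← hP] at hPπ₁ hπP₁ hΘπ₁ hPπ₂ hπP₂ hΘπ₂
  rw [← hπ₁] at hππ₁ hPπ₁ hπP₁ hEπ₁ hπE₁ hFπ₁ hπF₁ hΘπ₁
  rw [← hπ₂] at hππ₂ hPπ₂ hπP₂ hEπ₂ hπE₂ hFπ₂ hπF₂ hΘπ₂
  have hEE₁₂ : E₁ * E₂ = 0 := mul_eq_zero_of_plus_plus (K := ℂ) hPP hE₁ hE₂
  have hEE₂₁ : E₂ * E₁ = 0 := mul_eq_zero_of_plus_plus (K := ℂ) hPP hE₂ hE₁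
  have hFF₁₂ : F₁ * F₂ = 0 := mul_eq_zero_of_minus_minus (K := ℂ) hPP hF₁m hF₂m
  have hFF₂₁ : F₂ * F₁ = 0 := mul_eq_zero_of_minus_minus (K := ℂ) hPP hF₂m hF₁m
  -- cross relations of the projectors
  have hπ₁E₂ : π₁ * E₂ = 0 := by
    rw [hπ₁, smul_mul_assoc, add_mul, mul_assoc E₁ F₁ E₂, k21', mul_zero, zero_add, mul_assoc F₁ E₁ E₂, hEE₁₂,
      mul_zero, smul_zero]
  have hE₂π₁ : E₂ * π₁ = 0 := by
    rw [hπ₁, mul_smul_comm, mul_add, ← mul_assoc E₂ E₁ F₁, hEE₂₁, zero_mul, zero_add, ← mul_assoc E₂ F₁ E₁, k21,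
      zero_mul, smul_zero]
  have hπ₁F₂ : π₁ * F₂ = 0 := by
    rw [hπ₁, smul_mul_assoc, add_mul, mul_assoc E₁ F₁ F₂, hFF₁₂, mul_zero, zero_add, mul_assoc F₁ E₁ F₂, k12,
      mul_zero, smul_zero]
  have hF₂π₁ : F₂ * π₁ = 0 := by
    rw [hπ₁, mul_smul_comm, mul_add, ← mul_assoc F₂ E₁ F₁, k12', zero_mul, zero_add, ← mul_assoc F₂ F₁ E₁, hFF₂₁,
      zero_mul, smul_zero]
  have hπ₂E₁ : π₂ * E₁ = 0 := by
    rw [hπ₂, smul_mul_assoc, add_mul, mul_assoc E₂ F₂ E₁, k12', mul_zero, zero_add, mul_assoc F₂ E₂ E₁, hEE₂₁,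
      mul_zero, smul_zero]
  have hE₁π₂ : E₁ * π₂ = 0 := by
    rw [hπ₂, mul_smul_comm, mul_add, ← mul_assoc E₁ E₂ F₂, hEE₁₂, zero_mul, zero_add, ← mul_assoc E₁ F₂ E₂, k12,
      zero_mul, smul_zero]
  have hπ₂F₁ : π₂ * F₁ = 0 := by
    rw [hπ₂, smul_mul_assoc, add_mul, mul_assoc E₂ F₂ F₁, hFF₂₁, mul_zero, zero_add, mul_assoc F₂ E₂ F₁, k21,
      mul_zero, smul_zero]
  have hF₁π₂ : F₁ * π₂ = 0 := by
    rw [hπ₂, mul_smul_comm, mul_add, ← mul_assoc F₁ E₂ F₂, k21', zero_mul, zero_add, ← mul_assoc F₁ F₂ E₂, hFF₁₂,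
      zero_mul, smul_zero]
  have hπ₁π₂ : π₁ * π₂ = 0 := by
    rw [hπ₂, mul_smul_comm, mul_add, ← mul_assoc π₁ E₂ F₂, hπ₁E₂, zero_mul, zero_add, ← mul_assoc π₁ F₂ E₂, hπ₁F₂,
      zero_mul, smul_zero]
  have hπ₂π₁ : π₂ * π₁ = 0 := by
    rw [hπ₁, mul_smul_comm, mul_add, ← mul_assoc π₂ E₁ F₁, hπ₂E₁, zero_mul, zero_add, ← mul_assoc π₂ F₁ E₁, hπ₂F₁,
      zero_mul, smul_zero]
  -- `π₁`, `π₂`, `Θπᵢ` lie where they should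
  have hΘg : Θ ∈ H.hodgeLieC := (theta_mem_gradingZero H hn e hF hFc).1
  have hΘπ₁g : Θ * π₁ ∈ H.hodgeLieC := by
    rw [hΘπ₁]; exact H.hodgeLieC.smul_mem _ (H.commutator_mem_hodgeLieC hE₁g hF₁g)
  have hΘπ₂g : Θ * π₂ ∈ H.hodgeLieC := by
    rw [hΘπ₂]; exact H.hodgeLieC.smul_mem _ (H.commutator_mem_hodgeLieC hE₂g hF₂g)
  have hΘΘ : Θ * Θ = 1 := theta_mul_theta hPP
  have hΘ0 : Θ ≠ 0 := by
    intro h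
    have hE₁0 : E₁ ≠ 0 := fun h => one_ne_zero (hind 1 0 (by rw [h, smul_zero, zero_smul, add_zero])).1
    have h1 : (1 : Module.End ℂ (ℂ ⊗[ℚ] V)) = 0 := by rw [← hΘΘ, h, mul_zero]
    exact hE₁0 (by rw [← one_mul E₁, h1, zero_mul])
  have hcomm0 : ∀ Z ∈ H.hodgeLieC, P * Z = Z * P → ∀ Z' ∈ H.hodgeLieC, P * Z' = Z' * P → Z * Z' = Z' * Z := by
    intro Z hZ hZP Z' hZ' hZ'P
    refine gradingZero_comm H hn e hF hFc hΘ0 h02 ⟨hZ, ?_⟩ ⟨hZ', ?_⟩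
    · rw [SetLike.mem_coe, mem_eigenspace_adP_zero_iff]; exact hZP
    · rw [SetLike.mem_coe, mem_eigenspace_adP_zero_iff]; exact hZ'P
  -- `[Θ, E] = 2E`, `[Θ, F] = -2F`
  have hΘbr : ∀ {E F : Module.End ℂ (ℂ ⊗[ℚ] V)}, P * E * (1 - P) = E → (1 - P) * F * P = F →
      Θ * E - E * Θ = (2 : ℂ) • E ∧ Θ * F - F * Θ = -((2 : ℂ) • F) := fun {E F} hEm hFm => by
    obtain ⟨hPE, hEP, -, hPF, hFP, -⟩ := corner_identities (K := ℂ) hPP hEm hFm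
    exact theta_bracket hPE hEP hPF hFP
  -- a block-diagonal operator commuting with `E₁, E₂, F₁, F₂` on both sides of products commutes with `𝔤`
  have commute_of : ∀ T : Module.End ℂ (ℂ ⊗[ℚ] V), T ∈ H.hodgeLieC → P * T = T * P →
      T * E₁ = E₁ * T → T * E₂ = E₂ * T → T * F₁ = F₁ * T → T * F₂ = F₂ * T →
      ∀ Y ∈ H.hodgeLieC, T * Y = Y * T := by
    intro T hTg hTP hTE₁ hTE₂ hTF₁ hTF₂ Y hY
    obtain ⟨gE, gF, gZ⟩ := hodgeLieC_components_mem H e hF hFc hdeg hY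
    rw [← hP] at gE gF gZ
    obtain ⟨c1, c2, c3, hsum⟩ := components_mem_eigenspace_adP (K := ℂ) hPP Y
    rw [mem_eigenspace_adP_one_iff hPP] at c1
    rw [mem_eigenspace_adP_neg_one_iff hPP] at c2
    rw [mem_eigenspace_adP_zero_iff] at c3
    obtain ⟨x, y, hxy⟩ := hspanE _ gE c1
    obtain ⟨x', y', hxy'⟩ := hspanF _ gF c2
    have hZ := hcomm0 T hTg hTP _ gZ c3
    rw [← hsum, hxy, hxy', mul_add T, add_mul _ _ T, hZ, add_left_inj]
    simp only [mul_add, add_mul, mul_smul_comm, smul_mul_assoc, hTE₁, hTE₂, hTF₁, hTF₂]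
  -- `π₁ + π₂ = 1`
  have hsum1 : π₁ + π₂ = 1 := by
    set R : Module.End ℂ (ℂ ⊗[ℚ] V) := 1 - π₁ - π₂ with hR
    have hRE₁ : R * E₁ = 0 := by rw [hR, sub_mul, sub_mul, one_mul, hπE₁, hπ₂E₁, sub_self, zero_sub, neg_zero]
    have hE₁R : E₁ * R = 0 := by rw [hR, mul_sub, mul_sub, mul_one, hEπ₁, hE₁π₂, sub_self, zero_sub, neg_zero]
    have hRE₂ : R * E₂ = 0 := by rw [hR, sub_mul, sub_mul, one_mul, hπ₁E₂, hπE₂, sub_zero, sub_self]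
    have hE₂R : E₂ * R = 0 := by rw [hR, mul_sub, mul_sub, mul_one, hE₂π₁, hEπ₂, sub_zero, sub_self]
    have hRF₁ : R * F₁ = 0 := by rw [hR, sub_mul, sub_mul, one_mul, hπF₁, hπ₂F₁, sub_self, zero_sub, neg_zero]
    have hF₁R : F₁ * R = 0 := by rw [hR, mul_sub, mul_sub, mul_one, hFπ₁, hF₁π₂, sub_self, zero_sub, neg_zero]
    have hRF₂ : R * F₂ = 0 := by rw [hR, sub_mul, sub_mul, one_mul, hπ₁F₂, hπF₂, sub_zero, sub_self]
    have hF₂R : F₂ * R = 0 := by rw [hR, mul_sub, mul_sub, mul_one, hF₂π₁, hFπ₂, sub_zero, sub_self]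
    have hRP : P * R = R * P := by
      rw [hR, mul_sub, mul_sub, sub_mul, sub_mul, mul_one, one_mul, hPπ₁, hPπ₂, hπP₁, hπP₂]
    have hΘR_g : Θ * R ∈ H.hodgeLieC := by
      rw [hR, mul_sub, mul_sub, mul_one]
      exact H.hodgeLieC.sub_mem (H.hodgeLieC.sub_mem hΘg hΘπ₁g) hΘπ₂g
    have hΘP : P * Θ = Θ * P := by
      rw [hΘdef, mul_sub, sub_mul, mul_smul_comm, smul_mul_assoc, hPP, mul_one, one_mul]
    have hΘRP : P * (Θ * R) = Θ * R * P := by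
      rw [← mul_assoc, hΘP, mul_assoc, hRP, ← mul_assoc]
    -- `Θ R` kills the root vectors on both sides
    have aux : ∀ {X : Module.End ℂ (ℂ ⊗[ℚ] V)} {c : ℂ}, R * X = 0 → X * R = 0 → Θ * X - X * Θ = c • X →
        Θ * R * X = X * (Θ * R) := by
      intro X c hRX hXR hΘX
      have hXΘ : X * Θ = Θ * X - (Θ * X - X * Θ) := by abel
      rw [mul_assoc, hRX, mul_zero, ← mul_assoc, hXΘ, hΘX, sub_mul, smul_mul_assoc, mul_assoc, hXR, mul_zero,
        smul_zero, sub_zero]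
    have hneg : ∀ F : Module.End ℂ (ℂ ⊗[ℚ] V), -((2 : ℂ) • F) = (-2 : ℂ) • F := fun F => (neg_smul 2 F).symm
    have hcent : Θ * R = 0 :=
      eq_zero_of_mem_hodgeLieC_of_forall_commute H hcenter hΘR_g
        (commute_of _ hΘR_g hΘRP (aux hRE₁ hE₁R (hΘbr hE₁ hF₁m).1) (aux hRE₂ hE₂R (hΘbr hE₂ hF₂m).1)
          (aux hRF₁ hF₁R (((hΘbr hE₁ hF₁m).2).trans (hneg F₁))) (aux hRF₂ hF₂R (((hΘbr hE₂ hF₂m).2).trans (hneg F₂))))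
    have hR0 : R = 0 := by rw [← one_mul R, ← hΘΘ, mul_assoc, hcent, mul_zero]
    rw [hR, sub_sub, sub_eq_zero] at hR0
    exact hR0.symm
  -- `πᵢ ≠ 0`
  have hE₁0 : E₁ ≠ 0 := fun h => one_ne_zero (hind 1 0 (by rw [h, smul_zero, zero_smul, add_zero])).1
  have hE₂0 : E₂ ≠ 0 := fun h => one_ne_zero (hind 0 1 (by rw [h, smul_zero, zero_smul, zero_add])).2
  have hπ₁0 : π₁ ≠ 0 := fun h => hE₁0 (by rw [← hπE₁, h, zero_mul])
  have hπ₂0 : π₂ ≠ 0 := fun h => hE₂0 (by rw [← hπE₂, h, zero_mul])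
  -- reality of `πᵢ`
  have hreal : ∀ {E F : Module.End ℂ (ℂ ⊗[ℚ] V)} {α : ℂ}, (∀ v, F v = conj (E (conj v))) → starRingEnd ℂ α = α →
      ∀ v, (α⁻¹ • (E * F + F * E)) v = conj ((α⁻¹ • (E * F + F * E)) (conj v)) := by
    intro E F α hFE hαre v
    have hEF : ∀ v, E v = conj (F (conj v)) := fun v => by rw [hFE, conj_conj, conj_conj]
    rw [LinearMap.smul_apply, LinearMap.smul_apply, conj_smul, map_inv₀, hαre, LinearMap.add_apply, LinearMap.add_apply,
      map_add, conjOp_mul_apply hFE hEF, conjOp_mul_apply hEF hFE, add_comm]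
  -- `πᵢ` commutes with `𝔤⁰`
  have comm_zero : ∀ {E F Eo Fo π : Module.End ℂ (ℂ ⊗[ℚ] V)} {α : ℂ}, E ∈ H.hodgeLieC → F ∈ H.hodgeLieC →
      P * E * (1 - P) = E → (1 - P) * F * P = F →
      (∀ X ∈ H.hodgeLieC, P * X * (1 - P) = X → ∃ x y : ℂ, X = x • E + y • Eo) →
      (∀ X ∈ H.hodgeLieC, (1 - P) * X * P = X → ∃ x y : ℂ, X = x • F + y • Fo) →
      Eo * F = 0 → F * Eo = 0 → E * Fo = 0 → Fo * E = 0 → π = α⁻¹ • (E * F + F * E) → π * π = π → π ≠ 0 →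
      ∀ Z ∈ H.hodgeLieC, P * Z = Z * P → π * Z = Z * π := by
    intro E F Eo Fo π α hEg hFg hEm hFm hsE hsF hEoF hFEo hEFo hFoE hπ hππ hπ0 Z hZg hZP
    -- `[Z, E] = aE + bEo`, `[Z, F] = cF + dFo`
    obtain ⟨h1, -, h3, -⟩ := zero_mul_plus (K := ℂ) hPP hZP hEm hFm
    obtain ⟨-, h2, -, h4⟩ := zero_mul_plus (K := ℂ) hPP hZP hEm hFm
    have hZE : P * (Z * E - E * Z) * (1 - P) = Z * E - E * Z := by rw [mul_sub P, sub_mul, h1, h2]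
    have hZF : (1 - P) * (Z * F - F * Z) * P = Z * F - F * Z := by rw [mul_sub (1 - P), sub_mul, h3, h4]
    obtain ⟨a, b, hab⟩ := hsE _ (H.commutator_mem_hodgeLieC hZg hEg) hZE
    obtain ⟨c, d, hcd⟩ := hsF _ (H.commutator_mem_hodgeLieC hZg hFg) hZF
    -- `Z (EF + FE) − (EF + FE) Z = (a + c)(EF + FE)`
    have key : Z * (E * F + F * E) - (E * F + F * E) * Z = (a + c) • (E * F + F * E) := by
      have h : Z * (E * F + F * E) - (E * F + F * E) * Z =
          (Z * E - E * Z) * F + E * (Z * F - F * Z) + (Z * F - F * Z) * E + F * (Z * E - E * Z) := by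
        simp only [mul_add, add_mul, sub_mul, mul_sub, mul_assoc]; abel
      rw [h, hab, hcd]
      simp only [add_mul, mul_add, smul_mul_assoc, mul_smul_comm, hEoF, hEFo, hFoE, hFEo, smul_zero, add_zero]
      module
    have key' : Z * π - π * Z = (a + c) • π := by
      calc Z * π - π * Z = α⁻¹ • (Z * (E * F + F * E) - (E * F + F * E) * Z) := by
            rw [hπ, mul_smul_comm, smul_mul_assoc, smul_sub]
        _ = (a + c) • π := by rw [key, hπ, smul_comm]
    -- `π [Z, π] π = 0`
    have h0 : (a + c) • π = 0 := by
      have nfπ : ∀ X : Module.End ℂ (ℂ ⊗[ℚ] V), π * (π * X) = π * X := fun X => by rw [← mul_assoc, hππ]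
      have h := congrArg (fun T : Module.End ℂ (ℂ ⊗[ℚ] V) => π * T * π) key'
      simp only [mul_sub, sub_mul, mul_smul_comm, smul_mul_assoc, mul_assoc, hππ, nfπ, sub_self] at h
      exact h.symm
    have hac : a + c = 0 := (smul_eq_zero.1 h0).resolve_right hπ0
    rw [hac, zero_smul, sub_eq_zero] at key'
    exact key'.symm
  have hπ₁Z := comm_zero hE₁g hF₁g hE₁ hF₁m hspanE hspanF k21 k21' k12 k12' hπ₁ hππ₁ hπ₁0
  have hπ₂Z := comm_zero hE₂g hF₂g hE₂ hF₂m
    (fun X hXg hXm => by obtain ⟨x, y, h⟩ := hspanE X hXg hXm; exact ⟨y, x, by rw [h, add_comm]⟩)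
    (fun X hXg hXm => by obtain ⟨x, y, h⟩ := hspanF X hXg hXm; exact ⟨y, x, by rw [h, add_comm]⟩)
    k12 k12' k21 k21' hπ₂ hππ₂ hπ₂0
  -- `πᵢ` commutes with all of `𝔤`
  have hπ₁comm : ∀ Y ∈ H.hodgeLieC, π₁ * Y = Y * π₁ := by
    intro Y hY
    obtain ⟨gE, gF, gZ⟩ := hodgeLieC_components_mem H e hF hFc hdeg hY
    rw [← hP] at gE gF gZ
    obtain ⟨c1, c2, c3, hsum⟩ := components_mem_eigenspace_adP (K := ℂ) hPP Y
    rw [mem_eigenspace_adP_one_iff hPP] at c1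
    rw [mem_eigenspace_adP_neg_one_iff hPP] at c2
    rw [mem_eigenspace_adP_zero_iff] at c3
    obtain ⟨x, y, hxy⟩ := hspanE _ gE c1
    obtain ⟨x', y', hxy'⟩ := hspanF _ gF c2
    have hZ := hπ₁Z _ gZ c3
    rw [← hsum, hxy, hxy', mul_add π₁, add_mul _ _ π₁, hZ, add_left_inj]
    simp only [mul_add, add_mul, mul_smul_comm, smul_mul_assoc, hπE₁, hEπ₁, hπ₁E₂, hE₂π₁, hπF₁, hFπ₁, hπ₁F₂,
      hF₂π₁]
  have hπ₂comm : ∀ Y ∈ H.hodgeLieC, π₂ * Y = Y * π₂ := by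
    intro Y hY
    obtain ⟨gE, gF, gZ⟩ := hodgeLieC_components_mem H e hF hFc hdeg hY
    rw [← hP] at gE gF gZ
    obtain ⟨c1, c2, c3, hsum⟩ := components_mem_eigenspace_adP (K := ℂ) hPP Y
    rw [mem_eigenspace_adP_one_iff hPP] at c1
    rw [mem_eigenspace_adP_neg_one_iff hPP] at c2
    rw [mem_eigenspace_adP_zero_iff] at c3
    obtain ⟨x, y, hxy⟩ := hspanE _ gE c1
    obtain ⟨x', y', hxy'⟩ := hspanF _ gF c2
    have hZ := hπ₂Z _ gZ c3
    rw [← hsum, hxy, hxy', mul_add π₂, add_mul _ _ π₂, hZ, add_left_inj]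
    simp only [mul_add, add_mul, mul_smul_comm, smul_mul_assoc, hπE₂, hEπ₂, hπ₂E₁, hE₁π₂, hπF₂, hFπ₂, hπ₂F₁,
      hF₁π₂]
  -- descent to `End_Hdg ⊗ ℂ`
  have hπ₁span := H.mem_span_endAlg_of_forall_commute fun X hX => hπ₁comm _ (H.baseChange_mem_hodgeLieC hX)
  have hπ₂span := H.mem_span_endAlg_of_forall_commute fun X hX => hπ₂comm _ (H.baseChange_mem_hodgeLieC hX)
  -- `𝔤⁰ = ℂ[E₁,F₁] ⊕ ℂ[E₂,F₂]`
  have hH₁ : E₁ * F₁ - F₁ * E₁ = α₁ • (Θ * π₁) := by rw [hΘπ₁, smul_smul, mul_inv_cancel₀ hα₁, one_smul]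
  have hH₂ : E₂ * F₂ - F₂ * E₂ = α₂ • (Θ * π₂) := by rw [hΘπ₂, smul_smul, mul_inv_cancel₀ hα₂, one_smul]
  have hG0span : ∀ Z ∈ H.hodgeLieC, P * Z = Z * P →
      ∃ a b : ℂ, Z = a • (E₁ * F₁ - F₁ * E₁) + b • (E₂ * F₂ - F₂ * E₂) := by
    intro Z hZg hZP
    set G0 : Submodule ℂ (Module.End ℂ (ℂ ⊗[ℚ] V)) := H.hodgeLieC ⊓ Module.End.eigenspace
        (LinearMap.mulLeft ℂ P - LinearMap.mulRight ℂ P) 0 with hG0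
    have memG0 : ∀ {Z : Module.End ℂ (ℂ ⊗[ℚ] V)}, Z ∈ G0 ↔ Z ∈ H.hodgeLieC ∧ P * Z = Z * P := fun {Z} => by
      rw [hG0, Submodule.mem_inf, mem_eigenspace_adP_zero_iff]
    have hH₁P : P * (E₁ * F₁ - F₁ * E₁) = (E₁ * F₁ - F₁ * E₁) * P :=
      (mul_plus_minus_comm (K := ℂ) hPP hE₁ hF₁m).2.2.2.2.1
    have hH₂P : P * (E₂ * F₂ - F₂ * E₂) = (E₂ * F₂ - F₂ * E₂) * P :=
      (mul_plus_minus_comm (K := ℂ) hPP hE₂ hF₂m).2.2.2.2.1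
    have hind0 : LinearIndependent ℂ ![E₁ * F₁ - F₁ * E₁, E₂ * F₂ - F₂ * E₂] := by
      refine LinearIndependent.pair_iff.2 fun s t hst => ?_
      rw [hH₁, hH₂] at hst
      have h0 : (s * α₁) • π₁ + (t * α₂) • π₂ = 0 := by
        have h := congrArg (fun T : Module.End ℂ (ℂ ⊗[ℚ] V) => Θ * T) hst
        simp only [mul_add, mul_smul_comm, ← mul_assoc, hΘΘ, one_mul, mul_zero, smul_smul] at h
        exact h
      have h1 : (s * α₁) • π₁ = 0 := by
        have h := congrArg (fun T : Module.End ℂ (ℂ ⊗[ℚ] V) => T * π₁) h0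
        simp only [add_mul, smul_mul_assoc, hππ₁, hπ₂π₁, smul_zero, add_zero, zero_mul] at h
        exact h
      have h2 : (t * α₂) • π₂ = 0 := by
        have h := congrArg (fun T : Module.End ℂ (ℂ ⊗[ℚ] V) => T * π₂) h0
        simp only [add_mul, smul_mul_assoc, hππ₂, hπ₁π₂, smul_zero, zero_add, zero_mul] at h
        exact h
      exact ⟨(mul_eq_zero.1 ((smul_eq_zero.1 h1).resolve_right hπ₁0)).resolve_right hα₁,
        (mul_eq_zero.1 ((smul_eq_zero.1 h2).resolve_right hπ₂0)).resolve_right hα₂⟩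
    have hle : Submodule.span ℂ (Set.range ![E₁ * F₁ - F₁ * E₁, E₂ * F₂ - F₂ * E₂]) ≤ G0 := by
      rw [Submodule.span_le, Set.range_subset_iff]
      intro i; fin_cases i
      · exact memG0.2 ⟨H.commutator_mem_hodgeLieC hE₁g hF₁g, hH₁P⟩
      · exact memG0.2 ⟨H.commutator_mem_hodgeLieC hE₂g hF₂g, hH₂P⟩
    have hdim : Module.finrank ℂ G0 ≤
        Module.finrank ℂ (Submodule.span ℂ (Set.range ![E₁ * F₁ - F₁ * E₁, E₂ * F₂ - F₂ * E₂])) := by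
      rw [finrank_span_eq_card hind0, Fintype.card_fin, hG0, h02]
    have heq := Submodule.eq_of_le_of_finrank_le hle hdim
    have hZ' : Z ∈ Submodule.span ℂ (Set.range ![E₁ * F₁ - F₁ * E₁, E₂ * F₂ - F₂ * E₂]) := by
      rw [heq]; exact memG0.2 ⟨hZg, hZP⟩
    rw [Matrix.range_cons, Matrix.range_cons, Matrix.range_empty, Set.union_empty, Set.singleton_union,
      Submodule.mem_span_pair] at hZ'
    obtain ⟨a, b, hab⟩ := hZ'
    exact ⟨a, b, hab.symm⟩
  exact ⟨E₁, E₂, F₁, F₂, π₁, π₂, α₁, α₂, ⟨hE₁g, hE₂g, hF₁g, hF₂g⟩, ⟨hE₁, hE₂, hF₁m, hF₂m⟩, ⟨hF₁, hF₂⟩, hind,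
    hspanE, hspanF, ⟨k12, k12', k21, k21'⟩, ⟨hα₁, hα₂, hα₁re, hα₂re, hEFE₁, hFEF₁, hEFE₂, hFEF₂⟩, ⟨hπ₁, hπ₂⟩,
    ⟨hππ₁, hππ₂, hπ₁π₂, hπ₂π₁, hsum1⟩, ⟨hPπ₁.trans hπP₁.symm, hPπ₂.trans hπP₂.symm⟩,
    ⟨hreal hF₁ hα₁re, hreal hF₂ hα₂re⟩, ⟨hπ₁comm, hπ₂comm⟩, ⟨hπ₁span, hπ₂span⟩, ⟨hπ₁0, hπ₂0⟩, hG0span⟩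

end HodgeStructure

end Literature.AlgebraicGeometry.Motives

end
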